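import Mathlib.NumberTheory.Padics.RingHoms
import Mathlib.Tactic.NormNum.Prime
import Mathlib.Topology.Algebra.Valued.NormedValued
import Literature.NumberTheory.EllipticCurves.KubertTwoTwelveProofs
import HarnessLib

/-!
# Crux `MazurKenkuBound` (stmt-ABC-15125), line `radius-lite` — stub `stub_twentyonePoints`:
# the eight rational points of `21a1 = X₀(21)` from the finiteness of `E(ℚ)`

Kenku's level `21 = 3·7` of the rational-isogeny tables, modular-curve-free: a cyclic `21`-isogeny
gives a rational point of the fibre product `X₀(3) ×_{X(1)} X₀(7) = X₀(21)`, an elliptic curve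
isomorphic over `ℚ` to Cremona's `21a1 : y² + xy = x³ − 4x − 1` (`[1, 0, 0, -4, -1]`,
`Δ = 3969 = 3⁴·7²`), so the lead needs the complete list of rational points of `21a1`. The rank
(`E(ℚ)` finite) is the sibling stub `stub_twentyoneFinite`; THIS file turns finiteness into the list:

* `Summit.ABC.ABC.Theorems.stub_twentyonePoints`: if `E(ℚ)` is finite then every rational solution
  of `y² + xy = x³ − 4x − 1` is one of `(−2, 1), (−1, −1), (−1, 2), (−1/4, 1/8), (2, −1), (5, −13),
  (5, 8)` (with `O`, the eight points `E(ℚ) ≅ ℤ/4 × ℤ/2` of Cremona's Table 1, `21A1: r = 0,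
  |T| = 8`).

## The proof (the template is the tree's `KubertTwoTwelveProofs.lean`, curve `24A1`, primes `5, 7`)

1. `21a1` has good reduction at `5` and `11` (`Δ = 3969 = 3⁴·7²`) with `#Ẽ(𝔽₅) = #Ẽ(𝔽₁₁) = 8`
   (`natCard_point_reduction_five/eleven`, by enumeration of the affine solutions, `decide`).
2. The prime-to-`ℓ` torsion of `E(ℚ)` injects into `Ẽ(𝔽_ℓ)` (Silverman, *AEC*, Prop. VII.3.1(b);
   the tree's `Literature.NumberTheory.EllipticCurves.injective_reduceHom`, `PointReduction.lean`,
   for the `ℓ`-adic absolute value of `ℚ` and the residue map `ℤ_(ℓ) → ℤ_ℓ → 𝔽_ℓ`,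
   `exists_reduceHom`). For `P ∈ E(ℚ)` of finite order `n = 5ᵃm`, `5 ∤ m`, the point `mP` is
   killed by `5ᵃ`, hence lies in the prime-to-`11` torsion, hence is killed by `#Ẽ(𝔽₁₁) = 8`; so
   `8m P = 0` and `P` lies in the prime-to-`5` torsion: a finite `E(ℚ)` injects into `Ẽ(𝔽₅)`,
   `#E(ℚ) ≤ 8` (`natCard_point_le_eight`).
3. `O` and the seven listed pairs are eight distinct rational points, so they exhaust `E(ℚ)`
   (counting coordinate pairs through `P ↦ (x(P), y(P)) ∈ Option (ℚ × ℚ)`).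

## References

* [CremonaAlgorithms1997] J. E. Cremona, *Algorithms for Modular Elliptic Curves*, 2nd ed., CUP
  1997: Table 1, `N = 21`, curve `A1 = [1, 0, 0, -4, -1]`, `r = 0`, `|T| = 8`; §3.3 (torsion via
  reduction modulo good primes).
* [SilvermanAEC2009] J. H. Silverman, *The Arithmetic of Elliptic Curves*, 2nd ed., GTM 106:
  Prop. VII.3.1 (torsion injects into the reduction), VII.§2 (reduction modulo `π`).
* [Kenku1982] M. A. Kenku, J. Number Theory 15 (1982) 199–202, proof of Thm. 1 (level `21`).

## Design

* Theorems only (no definitions, no new facts); the curve is written literally as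
  `(⟨1, 0, 0, -4, -1⟩ : WeierstrassCurve ℚ)` and its reduction as
  `(⟨1, 0, 0, -4, -1⟩ : WeierstrassCurve (ZMod ℓ))`; the `ℓ`-adic absolute value of `ℚ` is
  `(NormedField.valuation.comap (Rat.castHom ℚ_[ℓ]) : Valuation ℚ ℝ≥0)` as in the template, whose
  generic local lemmas `Curve24A1.intCast_mem_integer`, `Curve24A1.valuation_natCast_eq_one` are
  reused by name.
* Helper lemmas in the sub-namespace `Summit.ABC.ABC.Theorems.Curve21A1Points` (distinct from the
  sibling stub files of the same skeleton); the group law on points is elaborated against the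
  classical `DecidableEq` instances (`letI := Classical.decEq _`), those of `PointReduction.lean`.
* The finiteness of `E(ℚ)` is a HYPOTHESIS throughout (it is the sibling stub, a `2`-descent).
-/

-- `Summit.ABC.ABC` is the mandated summit-side namespace (CONVENTIONS §2); the duplicate is deliberate.
set_option linter.dupNamespace false

noncomputable section

open scoped NNReal
open WeierstrassCurve WeierstrassCurve.Affine
open Literature.NumberTheory.EllipticCurves

namespace Summit.ABC.ABC.Theorems

namespace Curve21A1Points

/-! ### `21a1`, its reduction modulo `ℓ`, and its points over `𝔽₅` and `𝔽₁₁` -/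

/-- `Δ(21a1) = 3969 = 3⁴·7²` (Cremona, Table 1, `N = 21`, `A1 = [1, 0, 0, -4, -1]`).
[cite: CremonaAlgorithms1997, Table 1, N = 21, curve A1] -/
theorem Δ_eq : (⟨1, 0, 0, -4, -1⟩ : WeierstrassCurve ℚ).Δ = 3969 := by
  norm_num [WeierstrassCurve.Δ, b₂, b₄, b₆, b₈]

/-- `21a1` is an elliptic curve over `ℚ` (`Δ = 3969 ≠ 0`).
[cite: CremonaAlgorithms1997, Table 1, N = 21, curve A1] -/
theorem isElliptic : (⟨1, 0, 0, -4, -1⟩ : WeierstrassCurve ℚ).IsElliptic :=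
  ⟨by rw [Δ_eq]; norm_num⟩

/-- The affine equation of `21a1`: `y² + xy = x³ - 4x - 1`.
[cite: CremonaAlgorithms1997, Table 1, N = 21, curve A1] -/
theorem equation_iff (x y : ℚ) :
    (⟨1, 0, 0, -4, -1⟩ : WeierstrassCurve ℚ).toAffine.Equation x y ↔
      y ^ 2 + x * y = x ^ 3 - 4 * x - 1 := by
  rw [Affine.equation_iff]
  constructor <;> intro h <;> linear_combination h

/-- `Δ = 3969` for the reduction `[1, 0, 0, -4, -1]` of `21a1` modulo `ℓ` (the same integral
equation read over `ZMod ℓ`; Silverman, *AEC*, VII.§2, `Ẽ`), so that it is an elliptic curve over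
`𝔽_ℓ` for `ℓ ∤ 3969 = 3⁴·7²`. [cite: CremonaAlgorithms1997, Table 1, N = 21, curve A1] -/
theorem reduction_Δ (ℓ : ℕ) : (⟨1, 0, 0, -4, -1⟩ : WeierstrassCurve (ZMod ℓ)).Δ = 3969 := by
  norm_num [WeierstrassCurve.Δ, b₂, b₄, b₆, b₈]

/-- The affine equation of `21a1` modulo `ℓ`: `y² + xy = x³ - 4x - 1`.
[cite: CremonaAlgorithms1997, Table 1, N = 21, curve A1] -/
theorem equation_reduction_iff (ℓ : ℕ) (x y : ZMod ℓ) :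
    (⟨1, 0, 0, -4, -1⟩ : WeierstrassCurve (ZMod ℓ)).toAffine.Equation x y ↔
      y ^ 2 + x * y = x ^ 3 - 4 * x - 1 := by
  rw [Affine.equation_iff]
  constructor <;> intro h <;> linear_combination h

/-- `y² + xy = x³ - 4x - 1` has exactly `7` affine solutions over `𝔽₅`
(`(0, 2), (0, 3), (1, 2), (3, 1), (4, 1), (4, 3), (4, 4)` up to relabelling), by enumeration.
[folklore] -/
theorem card_solutions_five :
    Fintype.card {xy : ZMod 5 × ZMod 5 // xy.2 ^ 2 + xy.1 * xy.2 = xy.1 ^ 3 - 4 * xy.1 - 1} = 7 := by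
  decide

/-- `y² + xy = x³ - 4x - 1` has exactly `7` affine solutions over `𝔽₁₁`, by enumeration.
[folklore] -/
theorem card_solutions_eleven :
    Fintype.card {xy : ZMod 11 × ZMod 11 // xy.2 ^ 2 + xy.1 * xy.2 = xy.1 ^ 3 - 4 * xy.1 - 1} =
      7 := by
  decide

/-- **`#Ẽ(𝔽₅) = 8`** for `E = 21a1` (`7` affine points and `O`; equivalently `a₅ = -2`, Cremona
Table 1/3, `21A1`). [cite: CremonaAlgorithms1997, Table 1, N = 21, curve A1] -/
theorem natCard_point_reduction_five :
    Nat.card (⟨1, 0, 0, -4, -1⟩ : WeierstrassCurve (ZMod 5)).toAffine.Point = 8 := by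
  have h3969 : (3969 : ZMod 5) ≠ 0 := by decide
  haveI : Fact (Nat.Prime 5) := ⟨by norm_num⟩
  haveI : (⟨1, 0, 0, -4, -1⟩ : WeierstrassCurve (ZMod 5)).IsElliptic :=
    ⟨by rw [reduction_Δ]; exact isUnit_iff_ne_zero.mpr h3969⟩
  have e : {xy : ZMod 5 × ZMod 5 //
      (⟨1, 0, 0, -4, -1⟩ : WeierstrassCurve (ZMod 5)).toAffine.Equation xy.1 xy.2} ≃
      {xy : ZMod 5 × ZMod 5 // xy.2 ^ 2 + xy.1 * xy.2 = xy.1 ^ 3 - 4 * xy.1 - 1} :=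
    Equiv.subtypeEquivRight fun xy => equation_reduction_iff 5 xy.1 xy.2
  rw [Nat.card_congr (WeierstrassCurve.Affine.pointEquiv
    (⟨1, 0, 0, -4, -1⟩ : WeierstrassCurve (ZMod 5)).toAffine)]
  change Nat.card (Option _) = 8
  rw [Finite.card_option, Nat.card_congr e, Nat.card_eq_fintype_card, card_solutions_five]

/-- **`#Ẽ(𝔽₁₁) = 8`** for `E = 21a1` (`7` affine points and `O`; equivalently `a₁₁ = 4`, Cremona
Table 1/3, `21A1`). [cite: CremonaAlgorithms1997, Table 1, N = 21, curve A1] -/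
theorem natCard_point_reduction_eleven :
    Nat.card (⟨1, 0, 0, -4, -1⟩ : WeierstrassCurve (ZMod 11)).toAffine.Point = 8 := by
  have h3969 : (3969 : ZMod 11) ≠ 0 := by decide
  haveI : Fact (Nat.Prime 11) := ⟨by norm_num⟩
  haveI : (⟨1, 0, 0, -4, -1⟩ : WeierstrassCurve (ZMod 11)).IsElliptic :=
    ⟨by rw [reduction_Δ]; exact isUnit_iff_ne_zero.mpr h3969⟩
  have e : {xy : ZMod 11 × ZMod 11 //
      (⟨1, 0, 0, -4, -1⟩ : WeierstrassCurve (ZMod 11)).toAffine.Equation xy.1 xy.2} ≃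
      {xy : ZMod 11 × ZMod 11 // xy.2 ^ 2 + xy.1 * xy.2 = xy.1 ^ 3 - 4 * xy.1 - 1} :=
    Equiv.subtypeEquivRight fun xy => equation_reduction_iff 11 xy.1 xy.2
  rw [Nat.card_congr (WeierstrassCurve.Affine.pointEquiv
    (⟨1, 0, 0, -4, -1⟩ : WeierstrassCurve (ZMod 11)).toAffine)]
  change Nat.card (Option _) = 8
  rw [Finite.card_option, Nat.card_congr e, Nat.card_eq_fintype_card, card_solutions_eleven]

/-! ### Integrality, good reduction and the reduction map at a prime `ℓ ∤ 3969` -/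

section Local

variable (ℓ : ℕ) [Fact ℓ.Prime]

/-- `21a1` is an `ℓ`-integral equation (its coefficients are integers).
[cite: CremonaAlgorithms1997, Table 1, N = 21, curve A1] -/
theorem isIntegral :
    (⟨1, 0, 0, -4, -1⟩ : WeierstrassCurve ℚ).IsIntegral
      (NormedField.valuation.comap (Rat.castHom ℚ_[ℓ]) : Valuation ℚ ℝ≥0).integer :=
  ⟨⟨⟨1, Curve24A1.intCast_mem_integer ℓ 1⟩, ⟨0, Curve24A1.intCast_mem_integer ℓ 0⟩,
    ⟨0, Curve24A1.intCast_mem_integer ℓ 0⟩, ⟨-4, Curve24A1.intCast_mem_integer ℓ (-4)⟩,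
    ⟨-1, Curve24A1.intCast_mem_integer ℓ (-1)⟩⟩, rfl⟩

/-- **Good reduction**: for `ℓ` prime to `Δ(21a1) = 3969 = 3⁴·7²`, `‖Δ‖_ℓ = 1`.
[cite: CremonaAlgorithms1997, Table 1, N = 21, curve A1] -/
theorem valuation_Δ (h : IsCoprime (3969 : ℤ) ℓ) :
    (NormedField.valuation.comap (Rat.castHom ℚ_[ℓ]) : Valuation ℚ ℝ≥0)
      (⟨1, 0, 0, -4, -1⟩ : WeierstrassCurve ℚ).Δ = 1 := by
  rw [Δ_eq, Valuation.comap_apply, ← NNReal.coe_eq_one]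
  change ‖((3969 : ℚ) : ℚ_[ℓ])‖ = 1
  rw [show ((3969 : ℚ) : ℚ_[ℓ]) = ((3969 : ℤ) : ℚ_[ℓ]) by norm_cast]
  exact Padic.norm_intCast_eq_one_iff.mpr h

/-- **The prime-to-`ℓ` torsion of `21a1(ℚ)` injects into `Ẽ(𝔽_ℓ)`** at a prime `ℓ` of good
reduction (Silverman, *AEC*, Prop. VII.3.1(b) with Prop. VII.2.1: the reduction map is an
injective homomorphism on the torsion prime to the residue characteristic; here the tree's
`reduceHom` / `injective_reduceHom` of `PointReduction.lean` for the `ℓ`-adic absolute value of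
`ℚ`, the residue map `ℤ_(ℓ) → ℤ_ℓ → 𝔽_ℓ` — the inclusion into `ℤ_ℓ` followed by Mathlib's
`PadicInt.toZMod`, whose kernel is `{‖q‖_ℓ < 1}` (`PadicInt.ker_toZMod`) — and the reduced
equation `[1, 0, 0, -4, -1]` over `𝔽_ℓ`). The group laws are Mathlib's, elaborated against the
classical `DecidableEq` instances (those of `PointReduction.lean`).
[cite: SilvermanAEC2009, Prop. VII.3.1(b)] -/
theorem exists_reduceHom (h : IsCoprime (3969 : ℤ) ℓ) :
    letI := Classical.decEq ℚ
    letI := Classical.decEq (ZMod ℓ)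
    ∃ f : goodTorsion (NormedField.valuation.comap (Rat.castHom ℚ_[ℓ]) : Valuation ℚ ℝ≥0)
        (⟨1, 0, 0, -4, -1⟩ : WeierstrassCurve ℚ) →+
          (⟨1, 0, 0, -4, -1⟩ : WeierstrassCurve (ZMod ℓ)).toAffine.Point,
      Function.Injective f := by
  letI := Classical.decEq ℚ
  letI := Classical.decEq (ZMod ℓ)
  set w : Valuation ℚ ℝ≥0 := NormedField.valuation.comap (Rat.castHom ℚ_[ℓ]) with hw
  have hw1 : ∀ q : ℚ, w q ≤ 1 ↔ ‖(q : ℚ_[ℓ])‖ ≤ 1 := fun q => by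
    rw [hw, Valuation.comap_apply, ← NNReal.coe_le_coe, NNReal.coe_one]; rfl
  have hw1' : ∀ q : ℚ, w q < 1 ↔ ‖(q : ℚ_[ℓ])‖ < 1 := fun q => by
    rw [hw, Valuation.comap_apply, ← NNReal.coe_lt_coe, NNReal.coe_one]; rfl
  haveI : (⟨1, 0, 0, -4, -1⟩ : WeierstrassCurve ℚ).IsIntegral w.integer := isIntegral ℓ
  -- the residue map `ℤ_(ℓ) → ℤ_ℓ → 𝔽_ℓ`
  let ι : w.integer →+* ℤ_[ℓ] :=
    { toFun := fun a => ⟨((a : ℚ) : ℚ_[ℓ]), (hw1 a).mp a.2⟩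
      map_one' := Subtype.ext (by simp)
      map_mul' := fun a b => Subtype.ext (by simp)
      map_zero' := Subtype.ext (by simp)
      map_add' := fun a b => Subtype.ext (by simp) }
  let r : w.integer →+* ZMod ℓ := PadicInt.toZMod.comp ι
  have hr : ∀ a : w.integer, r a = 0 ↔ w (a : ℚ) < 1 := fun a => by
    rw [hw1', RingHom.comp_apply, ← RingHom.mem_ker, PadicInt.ker_toZMod,
      IsLocalRing.mem_maximalIdeal, PadicInt.mem_nonunits, PadicInt.norm_def]
    rfl
  have hΔ : w (⟨1, 0, 0, -4, -1⟩ : WeierstrassCurve ℚ).Δ = 1 := valuation_Δ ℓ h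
  -- the reduced equation
  have hred : reduceCurve r (⟨1, 0, 0, -4, -1⟩ : WeierstrassCurve ℚ) =
      (⟨1, 0, 0, -4, -1⟩ : WeierstrassCurve (ZMod ℓ)) := by
    ext
    · show reduceFun r (1 : ℚ) = 1
      rw [show (1 : ℚ) = ((1 : ℤ) : ℚ) by norm_num, reduceFun_intCast]; norm_num
    · show reduceFun r (0 : ℚ) = 0
      rw [show (0 : ℚ) = ((0 : ℤ) : ℚ) by norm_num, reduceFun_intCast]; norm_num
    · show reduceFun r (0 : ℚ) = 0
      rw [show (0 : ℚ) = ((0 : ℤ) : ℚ) by norm_num, reduceFun_intCast]; norm_num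
    · show reduceFun r (-4 : ℚ) = -4
      rw [show (-4 : ℚ) = ((-4 : ℤ) : ℚ) by norm_num, reduceFun_intCast]; norm_num
    · show reduceFun r (-1 : ℚ) = -1
      rw [show (-1 : ℚ) = ((-1 : ℤ) : ℚ) by norm_num, reduceFun_intCast]; norm_num
  exact ⟨reduceHom w r hr hΔ hred, injective_reduceHom hr hΔ hred⟩

end Local

/-! ### `#E(ℚ) ≤ 8` by reduction modulo `5` and `11`, for `E(ℚ)` finite -/

/-- **`#21a1(ℚ) ≤ 8` if `E(ℚ)` is finite** (the bound `|T| ≤ 8` behind Cremona's Table 1 entry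
`21A1: r = 0, |T| = 8`, obtained as in Cremona §3.3 / Silverman, *AEC*, VII.3.1 by reducing modulo
good primes). Every point `P` of a finite `E(ℚ)` has an order `n = 5ᵃ m`, `5 ∤ m`; then `mP` is
killed by `5ᵃ`, lies in the prime-to-`11` torsion, which injects into `Ẽ(𝔽₁₁)` of order `8`
(`exists_reduceHom`, `natCard_point_reduction_eleven`), so `8mP = 0` and `P` lies in the
prime-to-`5` torsion; the latter injects into `Ẽ(𝔽₅)` of order `8`.
[cite: CremonaAlgorithms1997, Table 1, N = 21, curve A1 (|T| = 8)] -/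
theorem natCard_point_le_eight (hfin : Finite (⟨1, 0, 0, -4, -1⟩ : WeierstrassCurve ℚ).toAffine.Point) :
    Nat.card (⟨1, 0, 0, -4, -1⟩ : WeierstrassCurve ℚ).toAffine.Point ≤ 8 := by
  letI := Classical.decEq ℚ
  letI : DecidableEq (ZMod 5) := Classical.decEq _
  letI : DecidableEq (ZMod 11) := Classical.decEq _
  haveI : Fact (Nat.Prime 5) := ⟨by norm_num⟩
  haveI : Fact (Nat.Prime 11) := ⟨by norm_num⟩
  obtain ⟨f₅, hf₅⟩ := exists_reduceHom 5 (by norm_num [Int.isCoprime_iff_gcd_eq_one])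
  obtain ⟨f₁₁, hf₁₁⟩ := exists_reduceHom 11 (by norm_num [Int.isCoprime_iff_gcd_eq_one])
  haveI : Finite (⟨1, 0, 0, -4, -1⟩ : WeierstrassCurve (ZMod 5)).toAffine.Point :=
    Nat.finite_of_card_ne_zero (by rw [natCard_point_reduction_five]; norm_num)
  -- every rational point lies in the prime-to-`5` torsion
  have hgood : ∀ P : (⟨1, 0, 0, -4, -1⟩ : WeierstrassCurve ℚ).toAffine.Point, P ∈ goodTorsion
      (NormedField.valuation.comap (Rat.castHom ℚ_[5]) : Valuation ℚ ℝ≥0)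
      (⟨1, 0, 0, -4, -1⟩ : WeierstrassCurve ℚ) := by
    intro P
    obtain ⟨n, hn, hnP⟩ := isOfFinAddOrder_iff_nsmul_eq_zero.mp (isOfFinAddOrder_of_finite P)
    obtain ⟨a, m, hm, rfl⟩ := Nat.exists_eq_pow_mul_and_not_dvd hn.ne' 5 (by norm_num)
    -- `m • P` is killed by `5 ^ a`, hence lies in the prime-to-`11` torsion
    have hR : m • P ∈ goodTorsion
        (NormedField.valuation.comap (Rat.castHom ℚ_[11]) : Valuation ℚ ℝ≥0)
        (⟨1, 0, 0, -4, -1⟩ : WeierstrassCurve ℚ) := by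
      refine mem_goodTorsion_of_zsmul_eq_zero (n := ((5 ^ a : ℕ) : ℤ)) ?_ ?_
      · rw [Int.cast_natCast]
        exact Curve24A1.valuation_natCast_eq_one 11 (Nat.Coprime.pow_right a (by norm_num))
      · rw [natCast_zsmul, ← mul_nsmul', hnP]
    -- hence is killed by `#Ẽ(𝔽₁₁) = 8`
    have h8 : 8 • (m • P) = 0 := by
      have key : (8 : ℕ) • (⟨m • P, hR⟩ : goodTorsion
          (NormedField.valuation.comap (Rat.castHom ℚ_[11]) : Valuation ℚ ℝ≥0)
          (⟨1, 0, 0, -4, -1⟩ : WeierstrassCurve ℚ)) = 0 := by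
        apply hf₁₁
        rw [map_nsmul, map_zero, ← natCard_point_reduction_eleven]
        exact card_nsmul_eq_zero'
      have key' := congrArg Subtype.val key
      simpa using key'
    refine mem_goodTorsion_of_zsmul_eq_zero (n := ((8 * m : ℕ) : ℤ)) ?_ ?_
    · rw [Int.cast_natCast]
      refine Curve24A1.valuation_natCast_eq_one 5 (Nat.Coprime.mul_right (by norm_num) ?_)
      exact (Nat.Prime.coprime_iff_not_dvd (by norm_num)).mpr hm
    · rw [natCast_zsmul, mul_nsmul', h8]
  -- so `E(ℚ)` injects into `Ẽ(𝔽₅)`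
  have hinj : Function.Injective fun P : (⟨1, 0, 0, -4, -1⟩ : WeierstrassCurve ℚ).toAffine.Point =>
      f₅ ⟨P, hgood P⟩ := by
    intro P Q hPQ
    have := hf₅ hPQ
    simpa using this
  calc Nat.card (⟨1, 0, 0, -4, -1⟩ : WeierstrassCurve ℚ).toAffine.Point
      ≤ Nat.card (⟨1, 0, 0, -4, -1⟩ : WeierstrassCurve (ZMod 5)).toAffine.Point :=
        Nat.card_le_card_of_injective _ hinj
    _ = 8 := natCard_point_reduction_five

end Curve21A1Points

/-! ### The stub: the eight rational points of `21a1` -/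

/-- **The rational points of `21a1`, from the finiteness of `E(ℚ)`** (Cremona, *Algorithms for
Modular Elliptic Curves*, Table 1, `N = 21`, curve `A1 = [1, 0, 0, -4, -1]`: `r = 0`, `|T| = 8`):
if `E(ℚ)` is finite, every rational solution of `y² + xy = x³ - 4x - 1` is one of
`(-2, 1), (-1, -1), (-1, 2), (-1/4, 1/8), (2, -1), (5, -13), (5, 8)`. Proof: these seven pairs and
`O` give eight distinct points of `E(ℚ)`, and `#E(ℚ) ≤ 8`
(`Curve21A1Points.natCard_point_le_eight`: torsion bounded by reduction modulo `5` and `11`,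
Silverman, *AEC*, VII.3.1), so they exhaust `E(ℚ)` (counted through the injection
`P ↦ (x(P), y(P))` into `Option (ℚ × ℚ)`).
[cite: CremonaAlgorithms1997, Table 1, N = 21, curve A1 (r = 0, |T| = 8)]
[cite: SilvermanAEC2009, Prop. VII.3.1] -/
theorem stub_twentyonePoints :
    Finite (⟨1, 0, 0, -4, -1⟩ : WeierstrassCurve ℚ).toAffine.Point →
      ∀ x y : ℚ, y ^ 2 + x * y = x ^ 3 - 4 * x - 1 →
        (x, y) ∈ ({(-2, 1), (-1, -1), (-1, 2), (-1 / 4, 1 / 8), (2, -1), (5, -13), (5, 8)} :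
          Finset (ℚ × ℚ)) := by
  intro hfin x y hxy
  haveI : (⟨1, 0, 0, -4, -1⟩ : WeierstrassCurve ℚ).IsElliptic := Curve21A1Points.isElliptic
  haveI := hfin
  letI : Fintype (⟨1, 0, 0, -4, -1⟩ : WeierstrassCurve ℚ).toAffine.Point := Fintype.ofFinite _
  have hns : ∀ {a b : ℚ}, (⟨1, 0, 0, -4, -1⟩ : WeierstrassCurve ℚ).toAffine.Equation a b →
      (⟨1, 0, 0, -4, -1⟩ : WeierstrassCurve ℚ).toAffine.Nonsingular a b :=
    fun hab => equation_iff_nonsingular.mp hab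
  -- coordinates
  let φ : (⟨1, 0, 0, -4, -1⟩ : WeierstrassCurve ℚ).toAffine.Point → Option (ℚ × ℚ) :=
    fun P => match P with
    | .zero => none
    | .some a b _ => some (a, b)
  have hφ : Function.Injective φ := by
    rintro (_ | ⟨a, b, h⟩) (_ | ⟨a', b', h'⟩) hPQ
    · rfl
    · exact (Option.some_ne_none _ hPQ.symm).elim
    · exact (Option.some_ne_none _ hPQ).elim
    · simp only [φ, Option.some.injEq, Prod.mk.injEq] at hPQ
      obtain ⟨rfl, rfl⟩ := hPQ
      rfl
  -- the eight known points, by coordinates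
  let T : Finset (Option (ℚ × ℚ)) :=
    {none, some (-2, 1), some (-1, -1), some (-1, 2), some (-1 / 4, 1 / 8), some (2, -1),
      some (5, -13), some (5, 8)}
  have hT : T.card = 8 := by
    simp only [T]
    rw [Finset.card_insert_of_notMem (by simp), Finset.card_insert_of_notMem (by norm_num),
      Finset.card_insert_of_notMem (by norm_num), Finset.card_insert_of_notMem (by norm_num),
      Finset.card_insert_of_notMem (by norm_num), Finset.card_insert_of_notMem (by norm_num),
      Finset.card_insert_of_notMem (by norm_num), Finset.card_singleton]
  have hpt : ∀ {a b : ℚ}, (⟨1, 0, 0, -4, -1⟩ : WeierstrassCurve ℚ).toAffine.Equation a b →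
      some (a, b) ∈ Finset.univ.image φ :=
    fun {a b} hab => Finset.mem_image.mpr ⟨.some a b (hns hab), Finset.mem_univ _, rfl⟩
  have hTsub : T ⊆ Finset.univ.image φ := by
    intro t ht
    simp only [T, Finset.mem_insert, Finset.mem_singleton] at ht
    rcases ht with rfl | rfl | rfl | rfl | rfl | rfl | rfl | rfl
    · exact Finset.mem_image.mpr ⟨0, Finset.mem_univ _, rfl⟩
    all_goals exact hpt ((Curve21A1Points.equation_iff _ _).mpr (by norm_num))
  have hcard : (Finset.univ.image φ).card ≤ T.card := by
    rw [hT]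
    calc (Finset.univ.image φ).card
        ≤ (Finset.univ : Finset (⟨1, 0, 0, -4, -1⟩ : WeierstrassCurve ℚ).toAffine.Point).card :=
          Finset.card_image_le
      _ = Nat.card (⟨1, 0, 0, -4, -1⟩ : WeierstrassCurve ℚ).toAffine.Point := by
          rw [Finset.card_univ, Nat.card_eq_fintype_card]
      _ ≤ 8 := Curve21A1Points.natCard_point_le_eight hfin
  have heq : T = Finset.univ.image φ := Finset.eq_of_subset_of_card_le hTsub hcard
  have hxy' : (⟨1, 0, 0, -4, -1⟩ : WeierstrassCurve ℚ).toAffine.Equation x y :=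
    (Curve21A1Points.equation_iff x y).mpr hxy
  have hmem : φ (.some x y (hns hxy')) ∈ T := by
    rw [heq]
    exact Finset.mem_image_of_mem φ (Finset.mem_univ (Affine.Point.some x y (hns hxy')))
  simp only [T, φ, Finset.mem_insert, Finset.mem_singleton, Option.some.injEq, reduceCtorEq,
    false_or] at hmem
  simp only [Finset.mem_insert, Finset.mem_singleton]
  exact hmem

end Summit.ABC.ABC.Theorems

end
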